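import Summits.NavierStokesRegularity.Statement
import Literature.Analysis.FluidPDE.SelfSimilar
import Literature.Analysis.FluidPDE.SuitableWeak
import Summits.NavierStokesRegularity.NavierStokesRegularity.Theorems.HubbleDynamoDynamoKillsTypeIZoom
import HarnessLib

/-!
# Route HubbleDynamo — `Assembly` (item stmt-NavierStokesRegularity-1940) from the zoom glue

Summits-side theorem file for the assembly item (rank 1) of route `HubbleDynamo` of
`NavierStokesRegularity` (Clay (A)):

`Assembly := NoSelfExcitedDynamo → FarFieldSlaving → NoTypeII → NoBlowupToClay → NavierStokesRegularity`.

It imports NO route (`Theses`) file: the route Props `NoSelfExcitedDynamo` (X1), `FarFieldSlaving`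
(X2), `NoTypeII`, `NoBlowupToClay`, `DynamoKillsTypeI` (the zoom glue, item
stmt-NavierStokesRegularity-1936) of
`Summits/NavierStokesRegularity/NavierStokesRegularity/Theses/HubbleDynamo.lean` are written out
verbatim, so that the types below are *definitionally* the route decls and the gate's
`Assembly_holds` link can import this module into the route file without an import cycle (same
pattern as `Theorems/TypeICertificateLadderLadderAssembly.lean`).

## Content

* `hubbleDynamo_assembly_of_glue : DynamoKillsTypeI → Assembly` — the planner's
  `assembly_of_glue` (route text: "PURE LOGIC given the zoom glue DynamoKillsTypeI"): fix
  `ν, T, u, p` as in `NoBlowup`; if `u` had no smooth extension past `T` it is maximal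
  (`IsMaximalSmoothSolution` := classical on `Ico 0 T` ∧ ¬ `HasSmoothExtensionPast`), `NoTypeII`
  gives the Type-I rate, the glue fed with X1 and X2 gives an extension — contradiction; hence
  `NoBlowup`, and `NoBlowupToClay` (= stmt-NavierStokesRegularity-0055) yields Clay (A). This is
  the argument of the route's deciding theorem `Theses.HubbleDynamo.closes`.

The unconditional `Assembly` is exactly as hard as the glue `DynamoKillsTypeI` (the KNSS zoom in
the pointwise Type-I class, item stmt-NavierStokesRegularity-1936): composing
`hubbleDynamo_assembly_of_glue` with a proof of the glue closes the item.

* `hubbleDynamo_assembly_proof : Assembly` — the item, unconditionally: the glue is discharged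
  inline from the tree's zoom in the pointwise class (`hubbleDynamo_zoom_unit`, KNSS 2009 §6 at
  unit viscosity, `Theorems/HubbleDynamoDynamoKillsTypeIZoom.lean`) after the viscosity
  normalisation `ν ↦ 1` (`typeIZoom_unit_viscosity`): `NoTypeII`'s Type-I bound
  `‖u(t, x)‖ ≤ C₀/√(T − t)` is the rate `√(T − t)‖u‖ ≤ C√ν` with `C = max(C₀, 1)/√ν > 0`; the
  normalised solution `v` (viscosity `1`, blow-up time `νT`) keeps the rate constant `C`, is again
  Type I, so `FarFieldSlaving` (at `ν = 1`) makes every point a space-time Type-I centre of `v`;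
  the zoom yields a bounded ancient mild solution with measurable slices, pointwise Type-I decay
  and a slice that is not a.e. zero — killed by `NoSelfExcitedDynamo`.
-/

namespace Summit.NavierStokesRegularity.NavierStokesRegularity.Theorems

open scoped Topology
open Filter Set

/-- **Assembly of route HubbleDynamo from the zoom glue** (towards item
stmt-NavierStokesRegularity-1940; the planner's `assembly_of_glue`). Hypotheses, in order, all
route Props of `Theses/HubbleDynamo.lean` unfolded verbatim:

* the zoom glue `DynamoKillsTypeI` (item stmt-NavierStokesRegularity-1936):
  `NoSelfExcitedDynamo → FarFieldSlaving → ` no Type-I blow-up for classical Leray–Hopf solutions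
  from rapidly decaying data;
* `NoSelfExcitedDynamo` (X1): bounded ancient mild solutions (`ν = 1`) with measurable slices and
  pointwise Type-I decay are trivial;
* `FarFieldSlaving` (X2): under the Type-I rate every point is a space-time Type-I centre;
* `NoTypeII`: a maximal smooth solution from a rapidly decaying Leray–Hopf datum blows up at most
  at the Type-I rate;
* `NoBlowupToClay`: "every such solution extends past every `T`" implies Clay (A).

Conclusion: `NavierStokesRegularity`; the last four arrows are literally the route decl
`Summit.NavierStokesRegularity.NavierStokesRegularity.Theses.HubbleDynamo.Assembly`.
Proof (pure logic, the route's deciding theorem `closes`): given `NoBlowupToClay` it suffices to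
extend an arbitrary classical Leray–Hopf rapidly-decaying-datum solution past `T`; if it did not
extend it would be maximal, hence Type I by `NoTypeII`, hence it extends by the glue applied to X1
and X2 — contradiction. -/
theorem hubbleDynamo_assembly_of_glue :
    -- `DynamoKillsTypeI` := X1 → X2 → no Type-I blow-up
    ((∀ u : ℝ → EuclideanSpace ℝ (Fin 3) → EuclideanSpace ℝ (Fin 3),
        Literature.Analysis.FluidPDE.IsBoundedAncientMildSolution 1 u →
        (∀ t < 0, MeasureTheory.AEStronglyMeasurable (u t) MeasureTheory.volume) →
        (∃ C : ℝ, Literature.Analysis.FluidPDE.HasTypeIDecay C u) →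
        ∀ t < 0, u t =ᵐ[MeasureTheory.volume] 0) →
      (∀ (ν T : ℝ), 0 < ν → 0 < T →
        ∀ (u : ℝ → EuclideanSpace ℝ (Fin 3) → EuclideanSpace ℝ (Fin 3))
          (p : ℝ → EuclideanSpace ℝ (Fin 3) → ℝ),
          Literature.Analysis.FluidPDE.IsClassicalNSSolutionOn (Set.Ico 0 T) ν 0 u p →
          Literature.Analysis.FluidPDE.IsLerayHopfOn T ν 0 (u 0) u →
          Literature.Analysis.FluidPDE.HasRapidSpatialDecay (u 0) →
          Literature.Analysis.FluidPDE.IsTypeIBlowup u T →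
          ∀ x₀ : EuclideanSpace ℝ (Fin 3), ∃ δ : ℝ, 0 < δ ∧ ∃ C : ℝ,
            ∀ t ∈ Set.Ioo (T - δ ^ 2) T, ∀ x ∈ Metric.ball x₀ δ,
              ‖u t x‖ ≤ C / (‖x - x₀‖ + Real.sqrt (T - t))) →
      ∀ (ν T : ℝ), 0 < ν → 0 < T →
        ∀ (u : ℝ → EuclideanSpace ℝ (Fin 3) → EuclideanSpace ℝ (Fin 3))
          (p : ℝ → EuclideanSpace ℝ (Fin 3) → ℝ),
          Literature.Analysis.FluidPDE.IsClassicalNSSolutionOn (Set.Ico 0 T) ν 0 u p →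
          Literature.Analysis.FluidPDE.IsLerayHopfOn T ν 0 (u 0) u →
          Literature.Analysis.FluidPDE.HasRapidSpatialDecay (u 0) →
          Literature.Analysis.FluidPDE.IsTypeIBlowup u T →
          Literature.Analysis.FluidPDE.HasSmoothExtensionPast ν 0 u T) →
    -- `NoSelfExcitedDynamo` (X1)
    (∀ u : ℝ → EuclideanSpace ℝ (Fin 3) → EuclideanSpace ℝ (Fin 3),
      Literature.Analysis.FluidPDE.IsBoundedAncientMildSolution 1 u →
      (∀ t < 0, MeasureTheory.AEStronglyMeasurable (u t) MeasureTheory.volume) →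
      (∃ C : ℝ, Literature.Analysis.FluidPDE.HasTypeIDecay C u) →
      ∀ t < 0, u t =ᵐ[MeasureTheory.volume] 0) →
    -- `FarFieldSlaving` (X2)
    (∀ (ν T : ℝ), 0 < ν → 0 < T →
      ∀ (u : ℝ → EuclideanSpace ℝ (Fin 3) → EuclideanSpace ℝ (Fin 3))
        (p : ℝ → EuclideanSpace ℝ (Fin 3) → ℝ),
        Literature.Analysis.FluidPDE.IsClassicalNSSolutionOn (Set.Ico 0 T) ν 0 u p →
        Literature.Analysis.FluidPDE.IsLerayHopfOn T ν 0 (u 0) u →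
        Literature.Analysis.FluidPDE.HasRapidSpatialDecay (u 0) →
        Literature.Analysis.FluidPDE.IsTypeIBlowup u T →
        ∀ x₀ : EuclideanSpace ℝ (Fin 3), ∃ δ : ℝ, 0 < δ ∧ ∃ C : ℝ,
          ∀ t ∈ Set.Ioo (T - δ ^ 2) T, ∀ x ∈ Metric.ball x₀ δ,
            ‖u t x‖ ≤ C / (‖x - x₀‖ + Real.sqrt (T - t))) →
    -- `NoTypeII`
    (∀ (ν T : ℝ), 0 < ν → 0 < T →
      ∀ (u : ℝ → EuclideanSpace ℝ (Fin 3) → EuclideanSpace ℝ (Fin 3))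
        (p : ℝ → EuclideanSpace ℝ (Fin 3) → ℝ),
        Literature.Analysis.FluidPDE.IsMaximalSmoothSolution ν 0 u p T →
        Literature.Analysis.FluidPDE.IsLerayHopfOn T ν 0 (u 0) u →
        Literature.Analysis.FluidPDE.HasRapidSpatialDecay (u 0) →
        Literature.Analysis.FluidPDE.IsTypeIBlowup u T) →
    -- `NoBlowupToClay`
    ((∀ (ν T : ℝ), 0 < ν → 0 < T →
        ∀ (u : ℝ → EuclideanSpace ℝ (Fin 3) → EuclideanSpace ℝ (Fin 3))
          (p : ℝ → EuclideanSpace ℝ (Fin 3) → ℝ),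
          Literature.Analysis.FluidPDE.IsClassicalNSSolutionOn (Set.Ico 0 T) ν 0 u p →
          Literature.Analysis.FluidPDE.IsLerayHopfOn T ν 0 (u 0) u →
          Literature.Analysis.FluidPDE.HasRapidSpatialDecay (u 0) →
          Literature.Analysis.FluidPDE.HasSmoothExtensionPast ν 0 u T) →
      NavierStokesRegularity) →
    NavierStokesRegularity := by
  intro hglue h₁ h₂ h₃ h₄
  apply h₄
  intro ν T hν hT u p hcl hLH hdec
  by_contra hext
  exact hext (hglue h₁ h₂ ν T hν hT u p hcl hLH hdec (h₃ ν T hν hT u p ⟨hcl, hext⟩ hLH hdec))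

/-! ### The item, unconditionally: the glue discharged by the zoom in the pointwise class -/

section Unconditional

open MeasureTheory Metric
open Literature.Analysis Literature.Analysis.FluidPDE

/-- **Assembly of route HubbleDynamo** (item stmt-NavierStokesRegularity-1940), stated without
importing the route file (the route Props are unfolded verbatim; this type is definitionally
`Summit.NavierStokesRegularity.NavierStokesRegularity.Theses.HubbleDynamo.Assembly`):

`NoSelfExcitedDynamo → FarFieldSlaving → NoTypeII → NoBlowupToClay → NavierStokesRegularity`.

Proof. By `hubbleDynamo_assembly_of_glue` it suffices to prove the zoom glue
`DynamoKillsTypeI`: X1 → X2 → no Type-I blow-up for a classical solution `(u, p)` (viscosity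
`ν > 0`) on `ℝ³ × [0, T)`, Leray–Hopf from its rapidly decaying datum. Suppose it does not extend
past `T`. Its Type-I bound `‖u(t, x)‖ ≤ C₀/√(T − t)` (eventually as `t ↑ T`) is the rate
`√(T − t)‖u(t, x)‖ ≤ C√ν` with `C = max(C₀, 1)/√ν > 0`. Normalise the viscosity
(`typeIZoom_unit_viscosity`, Leray's similarity `v(s, x) = ν⁻¹u(s/ν, x)`): `v` is classical with
viscosity `1` on `[0, νT)`, Leray–Hopf from its rapidly decaying datum, has the rate
`√(νT − s)‖v(s, x)‖ ≤ C` eventually — in particular it is Type I at `νT` — and does not extend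
past `νT`. X2 (`FarFieldSlaving`, at viscosity `1`) makes every point a space-time Type-I centre
of `v`, so the KNSS zoom in the pointwise class (`hubbleDynamo_zoom_unit`, KNSS 2009 §6 with
Lemma 6.1) produces a bounded ancient mild solution `W` (`ν = 1`) with a.e.-strongly measurable
slices, `HasTypeIDecay C' W`, and a slice `W t`, `t < 0`, that is not a.e. zero; X1
(`NoSelfExcitedDynamo`) says `W t` is a.e. zero — contradiction.
[cite: KochNadirashviliSereginSverak2009, §6 Thm 6.2 with Lemma 6.1 (arXiv:0709.3599 pp. 11–13)] -/
theorem hubbleDynamo_assembly_proof :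
    -- `NoSelfExcitedDynamo` (X1)
    (∀ u : ℝ → EuclideanSpace ℝ (Fin 3) → EuclideanSpace ℝ (Fin 3),
      Literature.Analysis.FluidPDE.IsBoundedAncientMildSolution 1 u →
      (∀ t < 0, MeasureTheory.AEStronglyMeasurable (u t) MeasureTheory.volume) →
      (∃ C : ℝ, Literature.Analysis.FluidPDE.HasTypeIDecay C u) →
      ∀ t < 0, u t =ᵐ[MeasureTheory.volume] 0) →
    -- `FarFieldSlaving` (X2)
    (∀ (ν T : ℝ), 0 < ν → 0 < T →
      ∀ (u : ℝ → EuclideanSpace ℝ (Fin 3) → EuclideanSpace ℝ (Fin 3))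
        (p : ℝ → EuclideanSpace ℝ (Fin 3) → ℝ),
        Literature.Analysis.FluidPDE.IsClassicalNSSolutionOn (Set.Ico 0 T) ν 0 u p →
        Literature.Analysis.FluidPDE.IsLerayHopfOn T ν 0 (u 0) u →
        Literature.Analysis.FluidPDE.HasRapidSpatialDecay (u 0) →
        Literature.Analysis.FluidPDE.IsTypeIBlowup u T →
        ∀ x₀ : EuclideanSpace ℝ (Fin 3), ∃ δ : ℝ, 0 < δ ∧ ∃ C : ℝ,
          ∀ t ∈ Set.Ioo (T - δ ^ 2) T, ∀ x ∈ Metric.ball x₀ δ,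
            ‖u t x‖ ≤ C / (‖x - x₀‖ + Real.sqrt (T - t))) →
    -- `NoTypeII`
    (∀ (ν T : ℝ), 0 < ν → 0 < T →
      ∀ (u : ℝ → EuclideanSpace ℝ (Fin 3) → EuclideanSpace ℝ (Fin 3))
        (p : ℝ → EuclideanSpace ℝ (Fin 3) → ℝ),
        Literature.Analysis.FluidPDE.IsMaximalSmoothSolution ν 0 u p T →
        Literature.Analysis.FluidPDE.IsLerayHopfOn T ν 0 (u 0) u →
        Literature.Analysis.FluidPDE.HasRapidSpatialDecay (u 0) →
        Literature.Analysis.FluidPDE.IsTypeIBlowup u T) →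
    -- `NoBlowupToClay`
    ((∀ (ν T : ℝ), 0 < ν → 0 < T →
        ∀ (u : ℝ → EuclideanSpace ℝ (Fin 3) → EuclideanSpace ℝ (Fin 3))
          (p : ℝ → EuclideanSpace ℝ (Fin 3) → ℝ),
          Literature.Analysis.FluidPDE.IsClassicalNSSolutionOn (Set.Ico 0 T) ν 0 u p →
          Literature.Analysis.FluidPDE.IsLerayHopfOn T ν 0 (u 0) u →
          Literature.Analysis.FluidPDE.HasRapidSpatialDecay (u 0) →
          Literature.Analysis.FluidPDE.HasSmoothExtensionPast ν 0 u T) →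
      NavierStokesRegularity) →
    NavierStokesRegularity := by
  refine hubbleDynamo_assembly_of_glue ?_
  -- the zoom glue `DynamoKillsTypeI`, discharged
  intro h₁ h₂ ν T hν hT u p hcl hLH hdec hI
  by_contra hext
  -- the Type-I bound as a rate `√(T − t)‖u‖ ≤ C√ν` with a positive constant
  obtain ⟨C₀, hC₀⟩ := hI
  have hsν : 0 < Real.sqrt ν := Real.sqrt_pos.2 hν
  set C : ℝ := max C₀ 1 / Real.sqrt ν with hCdef
  have hmax : 0 < max C₀ 1 := lt_of_lt_of_le one_pos (le_max_right _ _)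
  have hC : 0 < C := div_pos hmax hsν
  have hCν : C * Real.sqrt ν = max C₀ 1 := by
    rw [hCdef]
    exact div_mul_cancel₀ _ hsν.ne'
  have hrate : ∀ᶠ t in 𝓝[<] T, ∀ x, Real.sqrt (T - t) * ‖u t x‖ ≤ C * Real.sqrt ν := by
    filter_upwards [hC₀, self_mem_nhdsWithin] with t ht htT x
    have htT' : t < T := htT
    have hpos : 0 < Real.sqrt (T - t) := Real.sqrt_pos.2 (sub_pos.2 htT')
    have hmul : Real.sqrt (T - t) * (C₀ / Real.sqrt (T - t)) = C₀ :=
      mul_div_cancel₀ _ hpos.ne'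
    rw [hCν]
    calc Real.sqrt (T - t) * ‖u t x‖
        ≤ Real.sqrt (T - t) * (C₀ / Real.sqrt (T - t)) :=
          mul_le_mul_of_nonneg_left (ht x) hpos.le
      _ = C₀ := hmul
      _ ≤ max C₀ 1 := le_max_left _ _
  -- normalise the viscosity, keeping the rate constant `C`
  obtain ⟨v, π, hclv, hLHv, hdecv, hratev, hextv⟩ :=
    typeIZoom_unit_viscosity C ν T u p hν hT hcl hLH hdec hrate hext
  have hνT : 0 < ν * T := mul_pos hν hT
  -- the normalised solution is again Type I, so X2 applies to it at viscosity `1`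
  have hIv : IsTypeIBlowup v (ν * T) := by
    refine ⟨C, ?_⟩
    filter_upwards [hratev, self_mem_nhdsWithin] with s hs hsT x
    have hsT' : s < ν * T := hsT
    have hpos : 0 < Real.sqrt (ν * T - s) := Real.sqrt_pos.2 (sub_pos.2 hsT')
    rw [le_div_iff₀ hpos, mul_comm]
    exact hs x
  have hslave := h₂ 1 (ν * T) one_pos hνT v π hclv hLHv hdecv hIv
  -- the zoom in the pointwise class, killed by X1
  obtain ⟨W, hWsol, hWmeas, hWdecay, t, ht, hWne⟩ :=
    hubbleDynamo_zoom_unit hC hνT hclv hLHv hdecv hratev hslave hextv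
  exact hWne (h₁ W hWsol hWmeas hWdecay t ht)

end Unconditional

end Summit.NavierStokesRegularity.NavierStokesRegularity.Theorems
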